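import Summits.BirchSwinnertonDyer.BirchSwinnertonDyer.Theorems.KatoDescentPotSupersingularSelmerInftyDirectLimit
import Literature.NumberTheory.EllipticCurves.Kobayashi2003.SignedSelmerRankBoundProofs
import Literature.NumberTheory.EllipticCurves.Kobayashi2003.SignedSelmerGeneratorChangeProofs
import Literature.NumberTheory.EllipticCurves.IwasawaTowerTorsionProofs
import Summits.BirchSwinnertonDyer.Rank1Residual.Additive.BudgetFromRationalClasses
import HarnessLib

/-!
# A class of `H¹(K, E[p^∞])` that is Selmer over `K_∞` and Kummer above `p` restricts into Kobayashi's
# `Sel^ε(E/K_∞)` — the Kummer-at-`p` plumbing for the signed Cassels count (part 1 of 2)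

Route `ThetaPartnerAtTwo` (TP2), crux K4 `SignedControlAtTwo` (stmt-BirchSwinnertonDyer-20309), line `eulerchar`
v3: stub `stub_plusCasselsCountTwo` (CASSELS⁺@0 in count form: `Sel_{2^∞}(E/ℚ)` finite ⇒
`#(A⁺_0/Sel_0) = 2^{ord₂ ∏ c_ℓ}`, `A⁺_0 = h_0⁻¹(Sel⁺(E/ℚ_∞))`). This file REDUCES that stub to PRINT BY NAME
(`Greenberg1999.casselsSurjectivity_H1Sigma ℚ`: Greenberg's Prop. 4.13 / Cassels 1964, Poitou–Tate over `ℚ`,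
ANY `p`) + the local stub INJ⁺@2 («`r₂⁺` injective») + kernel — the `±` twin of the ♭ road's part 8
(`…SupersingularFlatCasselsCount`, `bsd-2adic-ss-1` GEN 12; credit for the template). Seat
`prover-bsd-wall-tp2-p3` (lead, LINE mode). HONEST FRAMING: THEOREMS ONLY (no definition, no named fact, no
`sorry`), route-independent; nothing about any curve is asserted beyond the displayed hypotheses; closes no item
by itself; BSD is not proved by any of this.

## What is proved (namespace `…Theorems.SignedEC`)

* §1 (any number field `K`, prime `p`, `ℤ_p`-extension `κ`, sign `ε`, `E(K)[p] = 0`)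
  `layerToInfty_mem_signedSelmerInfty_of_mem_selmerInfty_of_mem_localKerOver` — **a class of `H¹(K, E[p^∞])`
  whose restriction to `K_∞` is classically Selmer and which is Kummer (classical local condition) at the places
  above `p` restricts into `Sel^ε(E/K_∞)`**: `h_0 y = h_m y_m` with `y_m ∈ Sel(E/K_m)`
  (`mem_selmerInfty_iff_exists_layer`), `h_m` injective (e.g. `E(K)[p] = 0`, `Rank1Residual.Additive.layerToInfty_injective_of_no_pTorsion`), so `y_m = res y`, and a layer-`0`
  Kummer class restricts into the Kummer condition of `E(K_v) ≤ E^ε(K_m·K_v)` (Kobayashi: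
  «`E(ℚ_p) ⊆ E^±(F_{n,p})`», `localLayerPointsOfEmb_zero_le_signedLocalPointsOfEmb`).
The sequel `…SignedCasselsCount.lean` proves:
* §2 (`K = ℚ`, cyclotomic `κ`, any `p` with `E(ℚ)[p] = 0`) `forall_exists_mem_signedPreimage_localResOver_eq_of_cassels` —
  CASSELS at level `Γ_ℚ` (displayed: the body of `Greenberg1999.casselsSurjectivity_H1Sigma ℚ`) ⇒ the evaluation map
  `Φ : A^ε_0 → ∏_{w ∈ S} 𝒦_{w,0}[p^∞]` is ONTO; `natCard_signedKerG_eq_pow_of_cassels` — hence, with «`r_p^ε`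
  injective», **`#(A^ε_0/Sel_0) = p^{ord_p ∏ c_ℓ}`** (the ♭ road's generic
  `SSFlatEC.natCard_quotient_selmerLayer_zero_eq_prod_of_forall_exists` + Greenberg p. 88 count).
* §3 `natCard_signedKerG_eq_pow_of_casselsSurjectivity` — the same with Cassels BY NAME; and at `p = 2`,
  `GoodSS W 2`, `ε = 1`: `signedCasselsCountTwo_of_localInj_of_casselsSurjectivity` — **the registered stub
  `stub_plusCasselsCountTwo` ⟸ `Greenberg1999.casselsSurjectivity_H1Sigma ℚ` + INJ⁺@2** (`E(ℚ)[2] = 0` at good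
  supersingular `2`, `P2.irr_two_of_goodSS_two`).

References: [GreenbergLNM1716] §3 Lemma 3.3 and p. 88; §4 p. 104, Lemma 4.7 (p. 107), Prop. 4.13 and p. 122;
[Cassels1964ArithmeticVII]; [Kobayashi2003] Def. 1.1, Lemma 9.1; [BDKim2013] proof of Cor. 3.15 (pp. 199–200).
-/

set_option autoImplicit false
-- the Theorems namespace of this sub repeats the summit name by design (D-0017 nested layout)
set_option linter.dupNamespace false

noncomputable section

open scoped Classical NumberField

open NumberField IsDedekindDomain

universe u

namespace Summit.BirchSwinnertonDyer.BirchSwinnertonDyer.Theorems.SignedEC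

open Literature.NumberTheory.EllipticCurves Literature.NumberTheory.GaloisRepresentations
  WeierstrassCurve ZpExtension Literature.NumberTheory.EllipticCurves.Kobayashi2003
  Literature.NumberTheory.EllipticCurves.IwasawaDual
  Summit.BirchSwinnertonDyer.BirchSwinnertonDyer.Theorems.FineSelmerLeSignedSelmer

/-! ## §1 A layer-`0` class, Selmer over `K_∞` and Kummer above `p`, restricts into `Sel^ε(E/K_∞)` -/

section General

variable {K : Type u} [Field K] [NumberField K] (W : WeierstrassCurve K) [W.IsElliptic] {p : ℕ}
  [Fact p.Prime] (κ : ZpExtension K p) (ε : ℤˣ)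

omit [W.IsElliptic] in
/-- **A layer-`0` Kummer class restricts into the signed Kummer condition at every layer**: if
`y ∈ H¹(K, E[p^∞])` satisfies the classical local condition at the place `ι = closureEmb` above `v`
(`loc_v y = 0` in `H¹(K_v, E)`), then for every `m` and sign `ε`, `res_{K_m/K} y` satisfies Kobayashi's Kummer
condition cut out by `E^ε(K_m·K_v)` — because a class dying in `H¹(K_v, E)` is the Kummer class of a point of
`E(K_v)` (`localKerOverOfEmb_le_localKummerOverOfEmb_fixedPoints`), restriction preserves Kummer classes
(`resOfLe_mem_localKummerOverOfEmb`) and `E(K_v) = E(K_0·K_v) ≤ E^ε(K_m·K_v)` (Kobayashi: «`E(ℚ_p) ⊆ E^±(F_{n,p})`»,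
`localLayerPointsOfEmb_zero_le_signedLocalPointsOfEmb`). [cite: Kobayashi2003, Def. 1.1 (p. 2) and §2 p. 4] -/
theorem resOfLe_mem_localKummerOverOfEmb_signedLocalPoints_of_mem_localKerOver
    (v : HeightOneSpectrum (𝓞 K)) {y : W.subgroupH1 p (κ.layerSubgroup 0)}
    (hy : y ∈ W.localKerOver p (κ.layerSubgroup 0) (v.adicCompletion K)) (m : ℕ) :
    W.resOfLe p (κ.layerSubgroup_antitone (Nat.zero_le m)) y ∈
      localKummerOverOfEmb W p (κ.layerSubgroup m) (closureEmb (K := K) (v.adicCompletion K))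
        (signedLocalPoints κ (v.adicCompletion K) W ε m) := by
  rw [localKerOver_eq_ofEmb] at hy
  haveI : CompactSpace (Field.absoluteGaloisGroup K) := compactSpace_absoluteGaloisGroup K
  haveI : CompactSpace (κ.layerSubgroup 0) := isCompact_iff_compactSpace.mp
    (Subgroup.isClosed_of_isOpen _ (κ.isOpen_layerSubgroup 0)).isCompact
  have h1 := localKerOverOfEmb_le_localKummerOverOfEmb_fixedPoints W p (κ.layerSubgroup 0)
    (closureEmb (K := K) (v.adicCompletion K)) hy
  have h2 := resOfLe_mem_localKummerOverOfEmb W p (closureEmb (K := K) (v.adicCompletion K))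
    (κ.layerSubgroup_antitone (Nat.zero_le m)) _ h1
  refine localKummerOverOfEmb_mono ?_ h2
  rw [signedLocalPoints]
  exact localLayerPointsOfEmb_zero_le_signedLocalPointsOfEmb κ (closureEmb (K := K) (v.adicCompletion K)) W ε m

/-- **A class of `H¹(K, E[p^∞])` whose restriction to `K_∞` is classically Selmer and which is Kummer above
`p` restricts into `Sel^ε(E/K_∞)`** (any `K`, `p`, `ℤ_p`-extension, sign; `E(K)[p] = 0`). Proof: `h_0 y = h_m y_m`
with `y_m ∈ Sel_{p^∞}(E/K_m)` (`Sel(E/K_∞) = lim→ Sel(E/K_m)`, tree `mem_selmerInfty_iff_exists_layer`); `h_m` is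
injective, so `y_m = res_{K_m/K} y`; its conjugates are `res` of `conj_σ y = y`; and `res y` satisfies the signed
Kummer condition at every place above `p` (previous lemma). So `y_m ∈ Sel^ε(E/K_m)` and `h_0 y ∈ Sel^ε(E/K_∞)`.
[cite: Kobayashi2003, Def. 1.1 (p. 2), Lemma 9.1 (p. 25)] [cite: GreenbergLNM1716, §3 Lemma 3.1] -/
theorem layerToInfty_mem_signedSelmerInfty_of_mem_selmerInfty_of_mem_localKerOver
    (hinjh : ∀ m, Function.Injective (W.layerToInfty κ m)) {y : W.subgroupH1 p (κ.layerSubgroup 0)}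
    (hsel : W.layerToInfty κ 0 y ∈ W.selmerInfty κ)
    (hp : ∀ v : HeightOneSpectrum (𝓞 K), (p : 𝓞 K) ∈ v.asIdeal →
      y ∈ W.localKerOver p (κ.layerSubgroup 0) (v.adicCompletion K)) :
    W.layerToInfty κ 0 y ∈ signedSelmerInfty W κ ε := by
  obtain ⟨m, ym, hym, hm⟩ := (mem_selmerInfty_iff_exists_layer W κ _).mp hsel
  have hres : ym = W.resOfLe p (κ.layerSubgroup_antitone (Nat.zero_le m)) y := by
    apply hinjh m
    rw [hm, layerToInfty_resOfLe_layer W κ (Nat.zero_le m)]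
  rw [← hm]
  refine map_layerToInfty_signedSelmerLayer_le W κ ε m ⟨ym, ?_, rfl⟩
  change ym ∈ signedSelmerLayer W κ ε m
  rw [mem_signedSelmerLayer_iff]
  refine ⟨hym, fun v hv σ ↦ ?_⟩
  have hσ0 : W.conjH1 p (κ.layerSubgroup 0) σ y = y := by
    rw [W.conjH1_of_mem_holds p (κ.layerSubgroup 0)
      (show σ ∈ κ.layerSubgroup 0 by rw [ZpExtension.layerSubgroup_zero]; trivial), AddMonoidHom.id_apply]
  rw [hres, conjH1_resOfLe_layer W κ (Nat.zero_le m) σ y, hσ0]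
  exact resOfLe_mem_localKummerOverOfEmb_signedLocalPoints_of_mem_localKerOver W κ ε v
    (hp v (by exact_mod_cast hv)) m

end General

end Summit.BirchSwinnertonDyer.BirchSwinnertonDyer.Theorems.SignedEC

end
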